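import Mathlib
import Summits.Ventures.PercRepro2.CoinChainXATopGateFullAlg

/-!
# Gates supported on the sure-entered clusters — the affine decomposition and the hyperbola bound
(blind cell PercRepro2, night-2 g30; §72.12(d))

For a gate `d' = d·v` vanishing off the `m`-clusters, the (XA′) functional of `chain_XA'_gate_of_parts`
depends on the gate through four numbers — its mass `ω` on the top cell `{m, j, j'} ⊆ W`, its masses
`rx`, `ry` on the `x`-only / `y`-only `m`-clusters and its mass `r0` on the unmarked ones — and is AFFINE
in them: `F = F_top(ω) + α·r0 − (βx − α)·rx − (βy − α)·ry` (`cg_mgate_decomp`) with `F_top(ω)` the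
top-gate functional of `cg_top_full` at `w := ω`, `α = L·Px·Py + A′·Py + B′·Px ≥ 0`,
`βx = L²·Py + L·B′`, `βy = L²·Px + L·A′`.  `F_top(ω)` is affine in `ω`, hence nonnegative between its
endpoints `ω = 0` (the closed gate) and `ω = XYM` (the top gate) — `cg_top_of_endpoints`; and the
log-supermodularity of the gate law gives the hyperbola `rx·ry ≤ r0·ω`, so that
`ω·F ≥ ω·F_top(ω) + α·rx·ry − ω·(βx − α)·rx − ω·(βy − α)·ry` (`cg_mgate_lower`): the one-sided gate
masses are what remains (the corner inequalities of §72.12(d)).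
-/

namespace Summit.Ventures.PercRepro2.Coin

section MGateAlg

variable {R : Type*} [Field R] [LinearOrder R] [IsStrictOrderedRing R]

omit [LinearOrder R] [IsStrictOrderedRing R] in
/-- **The gate-on-`M` functional decomposes**: `F = F_top(ω) + α·r0 − (βx − α)·rx − (βy − α)·ry`. -/
theorem cg_mgate_decomp (a δ u t XJ XU XM YJ YU YM ω rx ry r0 : R) :
    (a + δ + u + t) * ((a + δ + u + t) * (a + δ + u + t) * ω - (a + δ + u + t) * (YJ + YU + YM) * (ω + rx) - (a + δ + u + t) * (XJ + XU + XM) * (ω + ry) + (XJ + XU + XM) * (YJ + YU + YM) * (a + (ω + rx + ry + r0))) - (((a + δ + u + t) * (XU + XM) - (XJ + XU + XM) * (a + u + t)) * ((a + δ + u + t) * (YJ + YU + (ω + ry)) - (YJ + YU + YM) * (a + δ + u + (ω + rx + ry + r0))) + ((a + δ + u + t) * (YU + YM) - (YJ + YU + YM) * (a + u + t)) * ((a + δ + u + t) * (XJ + XU + (ω + rx)) - (XJ + XU + XM) * (a + δ + u + (ω + rx + ry + r0)))) =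
      ((a) * (a + δ + u + t) * (XJ + XU + XM) * (YJ + YU + YM)
        - (XJ * (a + δ + u + t) - (δ) * (XJ + XU + XM)) * (YM * (a + δ + u + t) - t * (YJ + YU + YM))
        - (YJ * (a + δ + u + t) - (δ) * (YJ + YU + YM)) * (XM * (a + δ + u + t) - t * (XJ + XU + XM))
        + ω * ((a + δ + u + t) * ((a + δ + u + t) - (XJ + XU + XM)) * ((a + δ + u + t) - (YJ + YU + YM))
            + (XJ * (a + δ + u + t) - (δ) * (XJ + XU + XM)) * ((a + δ + u + t) - (YJ + YU + YM))
            + (YJ * (a + δ + u + t) - (δ) * (YJ + YU + YM)) * ((a + δ + u + t) - (XJ + XU + XM))))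
      + ((a + δ + u + t) * (XJ + XU + XM) * (YJ + YU + YM) + ((a + δ + u + t) * (XU + XM) - (XJ + XU + XM) * (a + u + t)) * (YJ + YU + YM) + ((a + δ + u + t) * (YU + YM) - (YJ + YU + YM) * (a + u + t)) * (XJ + XU + XM)) * r0 - (((a + δ + u + t) * (a + δ + u + t) * (YJ + YU + YM) + (a + δ + u + t) * ((a + δ + u + t) * (YU + YM) - (YJ + YU + YM) * (a + u + t))) - ((a + δ + u + t) * (XJ + XU + XM) * (YJ + YU + YM) + ((a + δ + u + t) * (XU + XM) - (XJ + XU + XM) * (a + u + t)) * (YJ + YU + YM) + ((a + δ + u + t) * (YU + YM) - (YJ + YU + YM) * (a + u + t)) * (XJ + XU + XM))) * rx - (((a + δ + u + t) * (a + δ + u + t) * (XJ + XU + XM) + (a + δ + u + t) * ((a + δ + u + t) * (XU + XM) - (XJ + XU + XM) * (a + u + t))) - ((a + δ + u + t) * (XJ + XU + XM) * (YJ + YU + YM) + ((a + δ + u + t) * (XU + XM) - (XJ + XU + XM) * (a + u + t)) * (YJ + YU + YM) + ((a + δ + u + t) * (YU + YM) - (YJ + YU + YM) * (a + u + t)) *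 (XJ + XU + XM))) * ry := by
  ring

/-- **The top-gate functional is nonnegative between its endpoints**: affine in `w`, nonnegative at
`w = 0` (the closed gate) and at `w = W` (the top gate), hence on `[0, W]`. -/
theorem cg_top_of_endpoints (a δ u t XJ XU XM YJ YU YM w W : R) (hw : 0 ≤ w) (hwW : w ≤ W)
    (h0 : 0 ≤ (a) * (a + δ + u + t) * (XJ + XU + XM) * (YJ + YU + YM)
        - (XJ * (a + δ + u + t) - (δ) * (XJ + XU + XM)) * (YM * (a + δ + u + t) - t * (YJ + YU + YM))
        - (YJ * (a + δ + u + t) - (δ) * (YJ + YU + YM)) * (XM * (a + δ + u + t) - t * (XJ + XU + XM))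
        + (0 : R) * ((a + δ + u + t) * ((a + δ + u + t) - (XJ + XU + XM)) * ((a + δ + u + t) - (YJ + YU + YM))
            + (XJ * (a + δ + u + t) - (δ) * (XJ + XU + XM)) * ((a + δ + u + t) - (YJ + YU + YM))
            + (YJ * (a + δ + u + t) - (δ) * (YJ + YU + YM)) * ((a + δ + u + t) - (XJ + XU + XM))))
    (hW : 0 ≤ (a) * (a + δ + u + t) * (XJ + XU + XM) * (YJ + YU + YM)
        - (XJ * (a + δ + u + t) - (δ) * (XJ + XU + XM)) * (YM * (a + δ + u + t) - t * (YJ + YU + YM))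
        - (YJ * (a + δ + u + t) - (δ) * (YJ + YU + YM)) * (XM * (a + δ + u + t) - t * (XJ + XU + XM))
        + W * ((a + δ + u + t) * ((a + δ + u + t) - (XJ + XU + XM)) * ((a + δ + u + t) - (YJ + YU + YM))
            + (XJ * (a + δ + u + t) - (δ) * (XJ + XU + XM)) * ((a + δ + u + t) - (YJ + YU + YM))
            + (YJ * (a + δ + u + t) - (δ) * (YJ + YU + YM)) * ((a + δ + u + t) - (XJ + XU + XM)))) :
    0 ≤ (a) * (a + δ + u + t) * (XJ + XU + XM) * (YJ + YU + YM)
        - (XJ * (a + δ + u + t) - (δ) * (XJ + XU + XM)) * (YM * (a + δ + u + t) - t * (YJ + YU + YM))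
        - (YJ * (a + δ + u + t) - (δ) * (YJ + YU + YM)) * (XM * (a + δ + u + t) - t * (XJ + XU + XM))
        + w * ((a + δ + u + t) * ((a + δ + u + t) - (XJ + XU + XM)) * ((a + δ + u + t) - (YJ + YU + YM))
            + (XJ * (a + δ + u + t) - (δ) * (XJ + XU + XM)) * ((a + δ + u + t) - (YJ + YU + YM))
            + (YJ * (a + δ + u + t) - (δ) * (YJ + YU + YM)) * ((a + δ + u + t) - (XJ + XU + XM))) := by
  have hWpos : 0 ≤ W := le_trans hw hwW
  rcases hWpos.lt_or_eq with hWp | hW0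
  · have key : 0 ≤ W * ((a) * (a + δ + u + t) * (XJ + XU + XM) * (YJ + YU + YM)
        - (XJ * (a + δ + u + t) - (δ) * (XJ + XU + XM)) * (YM * (a + δ + u + t) - t * (YJ + YU + YM))
        - (YJ * (a + δ + u + t) - (δ) * (YJ + YU + YM)) * (XM * (a + δ + u + t) - t * (XJ + XU + XM))
        + w * ((a + δ + u + t) * ((a + δ + u + t) - (XJ + XU + XM)) * ((a + δ + u + t) - (YJ + YU + YM))
            + (XJ * (a + δ + u + t) - (δ) * (XJ + XU + XM)) * ((a + δ + u + t) - (YJ + YU + YM))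
            + (YJ * (a + δ + u + t) - (δ) * (YJ + YU + YM)) * ((a + δ + u + t) - (XJ + XU + XM)))) := by
      have e : W * ((a) * (a + δ + u + t) * (XJ + XU + XM) * (YJ + YU + YM)
        - (XJ * (a + δ + u + t) - (δ) * (XJ + XU + XM)) * (YM * (a + δ + u + t) - t * (YJ + YU + YM))
        - (YJ * (a + δ + u + t) - (δ) * (YJ + YU + YM)) * (XM * (a + δ + u + t) - t * (XJ + XU + XM))
        + w * ((a + δ + u + t) * ((a + δ + u + t) - (XJ + XU + XM)) * ((a + δ + u + t) - (YJ + YU + YM))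
            + (XJ * (a + δ + u + t) - (δ) * (XJ + XU + XM)) * ((a + δ + u + t) - (YJ + YU + YM))
            + (YJ * (a + δ + u + t) - (δ) * (YJ + YU + YM)) * ((a + δ + u + t) - (XJ + XU + XM)))) = (W - w) * ((a) * (a + δ + u + t) * (XJ + XU + XM) * (YJ + YU + YM)
        - (XJ * (a + δ + u + t) - (δ) * (XJ + XU + XM)) * (YM * (a + δ + u + t) - t * (YJ + YU + YM))
        - (YJ * (a + δ + u + t) - (δ) * (YJ + YU + YM)) * (XM * (a + δ + u + t) - t * (XJ + XU + XM))
        + (0 : R) * ((a + δ + u + t) * ((a + δ + u + t) - (XJ + XU + XM)) * ((a + δ + u + t) - (YJ + YU + YM))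
            + (XJ * (a + δ + u + t) - (δ) * (XJ + XU + XM)) * ((a + δ + u + t) - (YJ + YU + YM))
            + (YJ * (a + δ + u + t) - (δ) * (YJ + YU + YM)) * ((a + δ + u + t) - (XJ + XU + XM)))) + w * ((a) * (a + δ + u + t) * (XJ + XU + XM) * (YJ + YU + YM)
        - (XJ * (a + δ + u + t) - (δ) * (XJ + XU + XM)) * (YM * (a + δ + u + t) - t * (YJ + YU + YM))
        - (YJ * (a + δ + u + t) - (δ) * (YJ + YU + YM)) * (XM * (a + δ + u + t) - t * (XJ + XU + XM))
        + W * ((a + δ + u + t) * ((a + δ + u + t) - (XJ + XU + XM)) * ((a + δ + u + t) - (YJ + YU + YM))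
            + (XJ * (a + δ + u + t) - (δ) * (XJ + XU + XM)) * ((a + δ + u + t) - (YJ + YU + YM))
            + (YJ * (a + δ + u + t) - (δ) * (YJ + YU + YM)) * ((a + δ + u + t) - (XJ + XU + XM)))) := by ring
      rw [e]; exact add_nonneg (mul_nonneg (by linarith) h0) (mul_nonneg hw hW)
    exact (mul_nonneg_iff_of_pos_left hWp).mp key
  · have hw0 : w = 0 := le_antisymm (hW0 ▸ hwW) hw
    rw [hw0]; exact h0

/-- **The hyperbola bound**: with `rx·ry ≤ r0·ω` and `α ≥ 0`,
`ω·F ≥ ω·F_top(ω) + α·rx·ry − ω·(βx − α)·rx − ω·(βy − α)·ry`. -/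
theorem cg_mgate_lower (a δ u t XJ XU XM YJ YU YM ω rx ry r0 : R)
    (hα : 0 ≤ ((a + δ + u + t) * (XJ + XU + XM) * (YJ + YU + YM) + ((a + δ + u + t) * (XU + XM) - (XJ + XU + XM) * (a + u + t)) * (YJ + YU + YM) + ((a + δ + u + t) * (YU + YM) - (YJ + YU + YM) * (a + u + t)) * (XJ + XU + XM))) (hhyp : rx * ry ≤ r0 * ω) :
    ω * ((a) * (a + δ + u + t) * (XJ + XU + XM) * (YJ + YU + YM)
        - (XJ * (a + δ + u + t) - (δ) * (XJ + XU + XM)) * (YM * (a + δ + u + t) - t * (YJ + YU + YM))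
        - (YJ * (a + δ + u + t) - (δ) * (YJ + YU + YM)) * (XM * (a + δ + u + t) - t * (XJ + XU + XM))
        + ω * ((a + δ + u + t) * ((a + δ + u + t) - (XJ + XU + XM)) * ((a + δ + u + t) - (YJ + YU + YM))
            + (XJ * (a + δ + u + t) - (δ) * (XJ + XU + XM)) * ((a + δ + u + t) - (YJ + YU + YM))
            + (YJ * (a + δ + u + t) - (δ) * (YJ + YU + YM)) * ((a + δ + u + t) - (XJ + XU + XM)))) + ((a + δ + u + t) * (XJ + XU + XM) * (YJ + YU + YM) + ((a + δ + u + t) * (XU + XM) - (XJ + XU + XM) * (a + u + t)) * (YJ + YU + YM) + ((a + δ + u + t) * (YU + YM) - (YJ + YU + YM) * (a + u + t)) * (XJ + XU + XM)) * (rx * ry) - ω * (((a + δ + u + t) * (a + δ + u + t) * (YJ + YU + YM) + (a + δ + u + t) * ((a + δ + u + t) * (YU + YM) - (YJ + YU + YM) * (a + u + t))) - ((a + δ + u + t) * (XJ + XU + XM) * (YJ + YU + YM) + ((a + δ + u + t) * (XU + XM) - (XJ + XU + XM) * (a + u + t)) * (YJ + YU + YM) + ((a + δ + u + t) * (YU +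 YM) - (YJ + YU + YM) * (a + u + t)) * (XJ + XU + XM))) * rx - ω * (((a + δ + u + t) * (a + δ + u + t) * (XJ + XU + XM) + (a + δ + u + t) * ((a + δ + u + t) * (XU + XM) - (XJ + XU + XM) * (a + u + t))) - ((a + δ + u + t) * (XJ + XU + XM) * (YJ + YU + YM) + ((a + δ + u + t) * (XU + XM) - (XJ + XU + XM) * (a + u + t)) * (YJ + YU + YM) + ((a + δ + u + t) * (YU + YM) - (YJ + YU + YM) * (a + u + t)) * (XJ + XU + XM))) * ry
      ≤ ω * ((a + δ + u + t) * ((a + δ + u + t) * (a + δ + u + t) * ω - (a + δ + u + t) * (YJ + YU + YM) * (ω + rx) - (a + δ + u + t) * (XJ + XU + XM) * (ω + ry) + (XJ + XU + XM) * (YJ + YU + YM) * (a + (ω + rx + ry + r0))) - (((a + δ + u + t) * (XU + XM) - (XJ + XU + XM) * (a + u + t)) * ((a + δ + u + t) * (YJ + YU + (ω + ry)) - (YJ + YU + YM) * (a + δ + u + (ω + rx + ry + r0))) + ((a + δ + u + t) * (YU + YM) - (YJ + YU + YM) * (a + u + t)) * ((a + δ + u + t) * (XJ + XU + (ω + rx))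 - (XJ + XU + XM) * (a + δ + u + (ω + rx + ry + r0))))) := by
  rw [cg_mgate_decomp]
  have h := mul_le_mul_of_nonneg_left hhyp hα
  nlinarith [h]

end MGateAlg

end Summit.Ventures.PercRepro2.Coin
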